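import Summits.RiemannHypothesis.RiemannHypothesis.Theorems.JensenPolynomialsFarGumbelAssembly
import Literature.NumberTheory.LFunctions.DeBruijnPhiComplexHead

/-!
# Route `JensenPolynomials`, FAR crux `XiWindowZeroFreeRelFar` (B1-rel far) — S3 pointwise input (Q): the kernel is its head on
the saddle line (RH-FREE; cell rh-jensen, HUMAN RULING D-0040)

Input (Q) of the S3 master assembly `FarGumbel.laplaceFar_of_pointwise` (`JensenPolynomialsFarGumbelAssembly`, eng-4 g3): along
every horizontal line `Im u = y`, `|y| ≤ 1/10`, and for every `Re u = x ≥ υ − 2` (`υ ≥ 189/20` the far mode), the complex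
Pólya–de Bruijn kernel `Φ_C` equals its HEAD `Φ₁(u) = 2π²e^{9u}e^{−πe^{4u}}` (`FarGumbel.phiHead`) up to the relative error

  `‖Φ_C(u)/Φ₁(u) − 1‖ ≤ 10⁻¹²`   (`head_ratio_line`, shape-matched to the hypothesis `hQ` of `laplaceFar_of_pointwise`).

Mechanism: the first theta term is `a₁(u) = Φ₁(u)·(1 − (3/2π)e^{−4u})` (`deBruijnPhiSummandC_zero_eq_phiHead_mul`), and
`‖Φ_C/a₁ − 1‖ ≤ 92e^{−3Y_c}`, `Y_c = πe^{4x}cos 4y` (eng-5 g3's `norm_deBruijnPhiC_div_head_sub_one_le`,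
`Literature/…/DeBruijnPhiComplexHead`); on the line `e^{−4x} ≤ e^{−29} < 10⁻¹²/3` and `Y_c ≥ 29`.
WHAT THIS IS NOT: an elementary estimate on the kernel `Φ`; nothing here bears on the zeros of `ζ` or the truth of RH.
References: Titchmarsh 1986 §10.1 [Titchmarsh1986]; Coffey–Csordas 2013 Prop. 2.1 [CoffeyCsordas2013]; theory g8's
S3-BLUEPRINT (item evidence #14 on `stmt-RiemannHypothesis-19465`).
-/

noncomputable section
-- D-0017: `Summit.RiemannHypothesis.RiemannHypothesis.…` duplicates the namespace BY DESIGN (single-problem summit).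
set_option linter.dupNamespace false

namespace Summit.RiemannHypothesis.RiemannHypothesis.Theorems.JensenPolynomials.FarGumbel

open Literature.NumberTheory.LFunctions Complex
open scoped Real

/-- The first theta term is the head times `1 − (3/2π)e^{−4u}`: `a₁(u) = Φ₁(u)·(1 − (3/(2π))·e^{−4u})`. -/
theorem deBruijnPhiSummandC_zero_eq_phiHead_mul (u : ℂ) :
    deBruijnPhiSummandC 0 u = phiHead u * (1 - (3 / (2 * π) : ℝ) * Complex.exp (-(4 * u))) := by
  have hπ : (π : ℂ) ≠ 0 := by exact_mod_cast Real.pi_ne_zero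
  have h5 : Complex.exp (5 * u) = Complex.exp (9 * u) * Complex.exp (-(4 * u)) := by
    rw [← Complex.exp_add]; ring_nf
  unfold deBruijnPhiSummandC phiHead
  push_cast
  simp only [zero_add, one_pow, mul_one]
  rw [h5]
  field_simp

/-- Numerics on the line: for `x ≥ 189/20 − 2`, `(3/(2π))·e^{−4x} ≤ 10⁻¹²/3` and `e^{4x} ≥ 10¹²`. -/
private theorem line_numerics {x : ℝ} (hx : (189 / 20 : ℝ) - 2 ≤ x) :
    3 / (2 * π) * Real.exp (-(4 * x)) ≤ 1 / (3 * 10 ^ 12) ∧ (10 : ℝ) ^ 12 ≤ Real.exp (4 * x) := by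
  have h1 : (2.7182818283 : ℝ) < Real.exp 1 := Real.exp_one_gt_d9
  have h0 : (0 : ℝ) ≤ 2.7182818283 := by norm_num
  have h29 : (3 * 10 ^ 12 : ℝ) < Real.exp 29 := by
    have : Real.exp 29 = Real.exp 1 ^ 29 := by rw [← Real.exp_nat_mul]; norm_num
    rw [this]
    exact lt_trans (by norm_num) (pow_lt_pow_left₀ h1 h0 (by norm_num : (29:ℕ) ≠ 0))
  have hmono : Real.exp 29 ≤ Real.exp (4 * x) := Real.exp_le_exp.2 (by linarith)
  have hπ3 : (3 : ℝ) < π := Real.pi_gt_three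
  refine ⟨?_, by linarith⟩
  rw [Real.exp_neg]
  have hE : 0 < Real.exp (4 * x) := Real.exp_pos _
  have hc : 3 / (2 * π) ≤ 1 / 2 := by
    rw [div_le_iff₀ (by positivity)]; linarith
  calc 3 / (2 * π) * (Real.exp (4 * x))⁻¹ ≤ 1 / 2 * (Real.exp (4 * x))⁻¹ :=
        mul_le_mul_of_nonneg_right hc (inv_nonneg.2 hE.le)
    _ = 1 / (2 * Real.exp (4 * x)) := by field_simp
    _ ≤ 1 / (3 * 10 ^ 12) := by
        apply one_div_le_one_div_of_le (by positivity); linarith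

/-- **(Q) THE KERNEL IS ITS HEAD ON THE SADDLE LINE.** For `υ ≥ 189/20`, `|y| ≤ 1/10` and every `x ≥ υ − 2`:
`‖Φ_C(x + iy)/Φ₁(x + iy) − 1‖ ≤ 10⁻¹²` (`Φ₁ = phiHead`). Shape-matched to hypothesis `hQ` of `laplaceFar_of_pointwise`
(`η = 1/10¹²`). -/
theorem head_ratio_line {υ y : ℝ} (hυ : (189 / 20 : ℝ) ≤ υ) (hy : |y| ≤ 1 / 10) :
    ∀ x : ℝ, υ - 2 ≤ x → ‖deBruijnPhiC (x + y * I) / phiHead (x + y * I) - 1‖ ≤ (1 / 10 ^ 12 : ℝ) := by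
  intro x hx
  set u : ℂ := x + y * I with hu
  have hure : u.re = x := by simp [hu]
  have huim : u.im = y := by simp [hu]
  have hx0 : (189 / 20 : ℝ) - 2 ≤ x := by linarith
  obtain ⟨hr, hE⟩ := line_numerics hx0
  -- hypotheses of the head-dominance lemma
  have hπ3 : (3 : ℝ) < π := Real.pi_gt_three
  have him : |u.im| < π / 8 := by rw [huim]; exact lt_of_le_of_lt hy (by linarith)
  have hxre : 0 ≤ u.re := by rw [hure]; linarith
  have hcos : (23 / 25 : ℝ) ≤ Real.cos (4 * u.im) := by
    rw [huim]
    have h := Real.one_sub_sq_div_two_le_cos (x := 4 * y)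
    have hy2 : (4 * y) ^ 2 ≤ (4 / 10) ^ 2 := by
      have := abs_le.1 hy
      nlinarith [this.1, this.2]
    linarith
  have hY : (29 : ℝ) ≤ π * Real.exp (4 * u.re) * Real.cos (4 * u.im) := by
    rw [hure]
    have h1 : (3 : ℝ) * 10 ^ 12 ≤ π * Real.exp (4 * x) := by nlinarith [Real.exp_pos (4 * x)]
    have h2 : π * Real.exp (4 * x) * (23 / 25) ≤ π * Real.exp (4 * x) * Real.cos (4 * u.im) :=
      mul_le_mul_of_nonneg_left hcos (by positivity)
    linarith
  have hY2 : (2 : ℝ) ≤ π * Real.exp (4 * u.re) * Real.cos (4 * u.im) := by linarith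
  have hdom := norm_deBruijnPhiC_div_head_sub_one_le u him hxre hY2
  -- `92 e^{-3Y_c} ≤ 92 e^{-87} ≤ 10⁻¹²/3`
  have hsmall : 92 * Real.exp (-(3 * (π * Real.exp (4 * u.re) * Real.cos (4 * u.im)))) ≤ 1 / (3 * 10 ^ 12) := by
    have hle : Real.exp (-(3 * (π * Real.exp (4 * u.re) * Real.cos (4 * u.im)))) ≤ Real.exp (-(87 : ℝ)) :=
      Real.exp_le_exp.2 (by linarith)
    have h87 : Real.exp (-(87 : ℝ)) ≤ 1 / (3 * 10 ^ 15) := by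
      have h1 : (2 : ℝ) < Real.exp 1 := lt_trans (by norm_num) Real.exp_one_gt_d9
      have h0 : (0 : ℝ) ≤ 2 := by norm_num
      have h87' : (3 * 10 ^ 15 : ℝ) < Real.exp 87 := by
        have : Real.exp 87 = Real.exp 1 ^ 87 := by rw [← Real.exp_nat_mul]; norm_num
        rw [this]
        exact lt_trans (by norm_num) (pow_lt_pow_left₀ h1 h0 (by norm_num : (87:ℕ) ≠ 0))
      rw [Real.exp_neg, ← one_div]
      exact one_div_le_one_div_of_le (by positivity) h87'.le
    linarith
  -- the algebra: `Φ_C/Φ₁ − 1 = (Φ_C/a₁ − 1)·(a₁/Φ₁) + (a₁/Φ₁ − 1)`, `a₁/Φ₁ = 1 − r`, `r = (3/2π)e^{−4u}`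
  set r : ℂ := (3 / (2 * π) : ℝ) * Complex.exp (-(4 * u)) with hrdef
  have hnr : ‖r‖ = 3 / (2 * π) * Real.exp (-(4 * x)) := by
    rw [hrdef, norm_mul, Complex.norm_real, Complex.norm_exp, Real.norm_of_nonneg (by positivity)]
    congr 1
    simp [hure]
  have hr' : ‖r‖ ≤ 1 / (3 * 10 ^ 12) := by rw [hnr]; exact hr
  have ha1 : deBruijnPhiSummandC 0 u = phiHead u * (1 - r) := deBruijnPhiSummandC_zero_eq_phiHead_mul u
  have hH : phiHead u ≠ 0 := phiHead_ne_zero u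
  have h1r : (1 : ℂ) - r ≠ 0 := by
    intro h
    have : ‖r‖ = 1 := by
      have : r = 1 := by linear_combination -h
      rw [this, norm_one]
    rw [this] at hr'
    norm_num at hr'
  have ha0 : deBruijnPhiSummandC 0 u ≠ 0 := by rw [ha1]; exact mul_ne_zero hH h1r
  have e : deBruijnPhiC u / phiHead u - 1 =
      (deBruijnPhiC u / deBruijnPhiSummandC 0 u - 1) * (1 - r) + (-r) := by
    rw [ha1]
    field_simp
    ring
  rw [e]
  calc ‖(deBruijnPhiC u / deBruijnPhiSummandC 0 u - 1) * (1 - r) + -r‖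
      ≤ ‖(deBruijnPhiC u / deBruijnPhiSummandC 0 u - 1) * (1 - r)‖ + ‖-r‖ := norm_add_le _ _
    _ = ‖deBruijnPhiC u / deBruijnPhiSummandC 0 u - 1‖ * ‖1 - r‖ + ‖r‖ := by rw [norm_mul, norm_neg]
    _ ≤ (1 / (3 * 10 ^ 12)) * (1 + 1 / (3 * 10 ^ 12)) + 1 / (3 * 10 ^ 12) := by
        have hA : ‖deBruijnPhiC u / deBruijnPhiSummandC 0 u - 1‖ ≤ 1 / (3 * 10 ^ 12) := hdom.trans hsmall
        have hB : ‖(1 : ℂ) - r‖ ≤ 1 + 1 / (3 * 10 ^ 12) := by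
          calc ‖(1 : ℂ) - r‖ ≤ ‖(1 : ℂ)‖ + ‖r‖ := norm_sub_le _ _
            _ ≤ 1 + 1 / (3 * 10 ^ 12) := by rw [norm_one]; linarith
        gcongr
    _ ≤ 1 / 10 ^ 12 := by norm_num

end Summit.RiemannHypothesis.RiemannHypothesis.Theorems.JensenPolynomials.FarGumbel

end
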